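import Literature.Barriers.AnomalousDissipation.RenormalisationNoAnomaly
import Literature.Analysis.FluidPDE.RenormalizationNoDissipationAnomaly
import Literature.Analysis.FluidPDE.PassiveScalarBoundedExistence
import Literature.Analysis.FluidPDE.PassiveScalarUniquenessBounded
import Literature.Analysis.FluidPDE.DEIJCriterion
import Literature.Analysis.FluidPDE.PassiveScalarEnergySlice
import HarnessLib

/-!
# Barrier (AnomalousDissipation), addendum: BBDM Thm. 3.1 on the FULL window under renormalisation
# BEYOND the window; the false vendored fact `BagnaraEtAl2026_thm31` and its correction
(D-0021 barrier catalogue for `Summits/AnomalousDissipation`; companion of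
`Barriers/AnomalousDissipation/RenormalisationNoAnomaly` — Bagnara–Boutros–De Lellis–Mayboroda,
arXiv:2603.11466v3 (2026), Def. 2.1 p. 5, Thm. 3.1 p. 11; everything PROVED, no named fact)

## Why this file exists (finding L30-1, ad-ideate lit seat, 2026-08-29)

The tree's weak class `Torus.IsWeakScalarTransportOn T κ u θ₀ θ` is posed on the HALF-OPEN window
`[0,T)`: its test fields vanish for `t ≥ T'` with some `T' < T` (`FunctionSpaces.Torus.IsSpaceTimeTest`).
Consequently BOTH renormalisation notions of the tree —
`Literature.Barriers.AnomalousDissipation.HasRenormalisationProperty T u` (barrier file) and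
`Literature.Analysis.FluidPDE.Torus.HasRenormalizationPropertyOn T u`
(`Analysis/FluidPDE/RenormalizationNoDissipationAnomaly`) — constrain the dynamics only strictly
before `T`.  The PRINTED Definition 2.1 is global in time (weak solutions on `T^d × [0,∞)`, tests in
`C¹_c(T^d × ℝ)`, p. 5), so the printed Theorem 3.1 sees the endpoint; the half-open notions do not.

* The named fact `Literature.Analysis.FluidPDE.BagnaraEtAl2026_thm31` concludes, from the half-open
  hypothesis on the horizon `T`, that the dissipation over the FULL window `(0,T)` tends to `0`.  This
  is FALSE AS TYPED: Drivas–Elgindi–Iyer–Jeong (ARMA 243 (2022), Thms. 1–2; arXiv:1911.03271 p. 3)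
  build `u ∈ C^∞([0,T) × T^d) ∩ L^∞([0,T] × T^d)`, divergence free, with
  `κ ∫₀ᵀ ‖∇θ^κ‖² ≥ χ‖θ₀‖²` for a bounded mean-zero datum — a THEOREM of the tree,
  `Literature.Analysis.FluidPDE.deij_anomalous_dissipation_eventually_holds`; such a field is Lipschitz on
  every `[0,t] × T^d`, `t < T`, hence renormalising on `[0,T)` in the tree's sense
  [cite: DiPernaLions1989, §II.3 Thm. II.3 and Cor. II.1], while its dissipation on `(0,T)` does not vanish.
  (The kernel refutation `¬ BagnaraEtAl2026_thm31` needs a renormalisation PRODUCER for such fields; not in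
  this file.)
* The barrier theorems `BagnaraBoutrosDeLellisMayboroda2026_thm31{,_strong}` are unaffected: their
  conclusions are on `[0,t₁]`, `t₁ < T`, resp. in `L²((0,T) × T^d)` (scope caveat (b) of the barrier).

## Contents (all proved)

* §1 bookkeeping: `eScalarDissipation` only sees the a.e. class of a.e. slice
  (`eScalarDissipation_congr_ae`); bounded data are a.e. bounded; the two renormalisation notions of
  the tree are EQUIVALENT (`hasRenormalisationProperty_iff_hasRenormalizationPropertyOn`) — the only
  difference is the currency of "bounded" (`MemLp (stLift θ) ∞` on the slab versus an iterated a.e.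
  bound), bridged by `isBoundedOnSlab_of_ae_ae_abs_le` / `ae_ae_abs_le_of_isBoundedOnSlab`.
* §2 **the weak maximum principle for the class at `κ > 0` along a bounded drift**
  (`Torus.IsWeakScalarTransportOn.ae_ae_abs_le_of_memLp_top`, dot-notation on the class): every weak solution with `|θ₀| ≤ H` a.e.
  satisfies `|θ(t,x)| ≤ H` for a.e. `t`, a.e. `x` (existence of a bounded solution,
  `exists_isWeakScalarTransportOn_of_abs_le`, plus uniqueness for bounded drifts,
  `IsWeakScalarTransportOn.ae_eq_of_memLp_top` [cite: BonicattoCiampaCrippa2023, Cor. 3.5]).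
* §3 **BBDM Thm. 3.1 (3.1) ON THE FULL WINDOW** (`BagnaraBoutrosDeLellisMayboroda2026_thm31_fullWindow`):
  if the bounded divergence-free drift has the renormalisation property on a LONGER horizon `T' > T`,
  then for EVERY family of weak solutions `θₙ` of the `κₙ`-problems on `[0,T)`, `κₙ ↓ 0`,
  `κₙ ∫₀ᵀ ‖∇θₙ‖² → 0` — no boundedness hypothesis on `θₙ` (automatic by §2).  Proof: solve on `[0,T')`
  with the bound `‖θ₀‖_∞` (`exists_isWeakScalarTransportOn_of_abs_le`), apply the barrier theorem on the
  horizon `T'` at `t₁ = T < T'`, and transfer to `θₙ` by uniqueness on `[0,T)` (`of_le`,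
  `ae_eq_of_memLp_top`).  Filter form along `ε → 0⁺` for real-indexed families:
  `BagnaraBoutrosDeLellisMayboroda2026_thm31_fullWindow_nhdsWithin`.
* §4 in the vocabulary of `RenormalizationNoDissipationAnomaly`: no dissipation anomaly on `[0,T]`
  (BBDM Def. 1.1) for a drift renormalising beyond `T`
  (`Torus.not_allowsDissipationAnomalyOn_of_hasRenormalizationPropertyOn_beyond`), and **Theorem 1.2 as
  typed from §2.2 alone** (`BagnaraEtAl2026_thm12_of_core : BagnaraEtAl2026_thm12_core → BagnaraEtAl2026_thm12`),
  replacing the reduction `BagnaraEtAl2026_thm12_of` through the false `BagnaraEtAl2026_thm31`: an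
  autonomous field renormalising on every horizon renormalises on `T + 1 > T`.

NOT: no statement about the Navier–Stokes summit `Literature.Turb.ZerothLaw`; passive scalars only.

## References
* M. Bagnara, D. W. Boutros, C. De Lellis, S. Mayboroda, arXiv:2603.11466v3 (2026), Def. 1.1 p. 2,
  Def. 2.1 p. 5, Thm. 1.2 pp. 2–3, Thm. 3.1 p. 11 (proof pp. 11–12). [`BagnaraEtAl2026`]
* T. D. Drivas, T. M. Elgindi, G. Iyer, I.-J. Jeong, Arch. Ration. Mech. Anal. 243 (2022), Thms. 1–2
  (arXiv:1911.03271, p. 3). [`DrivasEtAl2022`]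
* R. J. DiPerna, P.-L. Lions, Invent. Math. 98 (1989), §II.3. [`DiPernaLions1989`]
* P. Bonicatto, G. Ciampa, G. Crippa, J. Math. Pures Appl. (2024), Cor. 3.5. [`BonicattoCiampaCrippa2023`]
-/

open MeasureTheory Set Filter Topology Function
open scoped ENNReal NNReal

noncomputable section

namespace Literature.Barriers.AnomalousDissipation

open Literature.Analysis.FluidPDE Literature.Analysis.FluidPDE.Torus Literature.Analysis

variable {d : Type*} [Fintype d]

/-! ## §1 Bookkeeping: a.e. classes, bounded data, the two renormalisation currencies -/

/-- `eScalarGradNormSq` only depends on the a.e. class of the slice (spectral quantity: Fourier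
coefficients are integrals). [folklore] -/
private theorem eScalarGradNormSq_congr_ae {f g : UnitAddTorus d → ℝ} (h : f =ᵐ[volume] g) :
    eScalarGradNormSq f = eScalarGradNormSq g := by
  rw [eScalarGradNormSq_eq_tsum, eScalarGradNormSq_eq_tsum]
  congr 1
  refine tsum_congr fun k => ?_
  rw [FunctionSpaces.Torus.mFourierCoeff_congr_ae (f := fun x => (f x : ℂ)) (g := fun x => (g x : ℂ))
    (h.mono fun x hx => by simp only [hx]) k]

/-- **The dissipation functional only sees a.e. slices up to a.e. modification**: if
`θ₁(t) = θ₂(t)` a.e. for a.e. `t ∈ (0,T)`, then `κ ∫₀ᵀ ‖∇θ₁‖² = κ ∫₀ᵀ ‖∇θ₂‖²`. [folklore] -/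
private theorem eScalarDissipation_congr_ae {κ T : ℝ} {θ₁ θ₂ : ℝ → UnitAddTorus d → ℝ}
    (h : ∀ᵐ t ∂(volume.restrict (Ioo 0 T)), θ₁ t =ᵐ[volume] θ₂ t) :
    eScalarDissipation κ θ₁ 0 T = eScalarDissipation κ θ₂ 0 T := by
  unfold eScalarDissipation
  congr 1
  exact lintegral_congr_ae (h.mono fun t ht => eScalarGradNormSq_congr_ae ht)

/-- A bounded datum is a.e. bounded by `‖θ₀‖_{L^∞}`. [folklore] -/
private theorem ae_abs_le_toReal_eLpNorm_of_memLp_top {θ₀ : UnitAddTorus d → ℝ} (hθ₀ : MemLp θ₀ ∞ volume) :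
    ∀ᵐ x ∂(volume : Measure (UnitAddTorus d)), |θ₀ x| ≤ (eLpNorm θ₀ ∞ volume).toReal := by
  filter_upwards [ae_le_eLpNormEssSup (f := θ₀) (μ := (volume : Measure (UnitAddTorus d)))] with x hx
  rw [← eLpNorm_exponent_top] at hx
  rw [← Real.norm_eq_abs, ← ENNReal.ofReal_le_iff_le_toReal hθ₀.eLpNorm_ne_top, ofReal_norm]
  exact hx

/-- **Iterated a.e. bound ⇒ `L^∞` on the slab (lifted currency).** For a field whose space–time
lift is a.e.-strongly measurable on `(0,T) × ℝ^d`, an iterated bound `|θ(t,x)| ≤ M` (a.e. `t`, a.e.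
`x ∈ T^d`) gives `MemLp (stLift θ) ∞` on the slab, i.e. `Torus.IsBoundedOnSlab T θ` (Tonelli on a
measurable modification, then the quasi-measure-preserving covering `id × proj`). [folklore] -/
private theorem isBoundedOnSlab_of_ae_ae_abs_le {T M : ℝ} {θ : ℝ → UnitAddTorus d → ℝ}
    (hm : AEStronglyMeasurable (FunctionSpaces.Torus.stLift θ) (volume.restrict (Ioo 0 T ×ˢ univ)))
    (hb : ∀ᵐ t ∂(volume.restrict (Ioo 0 T)), ∀ᵐ x ∂(volume : Measure (UnitAddTorus d)), |θ t x| ≤ M) :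
    IsBoundedOnSlab T θ := by
  set μT : Measure ℝ := (volume : Measure ℝ).restrict (Ioo 0 T) with hμT
  set P : Measure (ℝ × UnitAddTorus d) := μT.prod volume with hP
  -- product-a.e. bound on `(0,T) × T^d`
  have hmu : AEStronglyMeasurable (uncurry θ) P := by
    rw [hP, hμT, ← volume_restrict_prod_eq]
    exact FunctionSpaces.Torus.aestronglyMeasurable_uncurry_of_stLift_restrict hm
  set θ' : ℝ × UnitAddTorus d → ℝ := hmu.mk (uncurry θ) with hθ'
  have hθ'm : Measurable θ' := hmu.stronglyMeasurable_mk.measurable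
  have hθθ' : uncurry θ =ᵐ[P] θ' := hmu.ae_eq_mk
  have hS : MeasurableSet {p : ℝ × UnitAddTorus d | |θ' p| ≤ M} :=
    measurableSet_le (continuous_abs.measurable.comp hθ'm) measurable_const
  have h1 : ∀ᵐ t ∂μT, ∀ᵐ x ∂(volume : Measure (UnitAddTorus d)), |θ' (t, x)| ≤ M := by
    filter_upwards [hb, Measure.ae_ae_of_ae_prod hθθ'] with t ht ht'
    filter_upwards [ht, ht'] with x hx hx'
    simp only [uncurry] at hx'
    rw [← hx']; exact hx
  have h2 : ∀ᵐ p ∂P, |θ' p| ≤ M := by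
    rw [hP, Measure.ae_prod_iff_ae_ae hS]
    exact h1
  have h3 : ∀ᵐ p ∂P, |uncurry θ p| ≤ M := by
    filter_upwards [h2, hθθ'] with p hp hp'
    rw [hp']; exact hp
  -- lift to `(0,T) × ℝ^d` along the quasi-measure-preserving `id × proj`
  have hq := MeasureTheory.QuasiMeasurePreserving.prodMap
    (Measure.QuasiMeasurePreserving.id μT) (FunctionSpaces.Torus.quasiMeasurePreserving_proj (d := d))
  have h4 : ∀ᵐ q ∂(μT.prod (volume : Measure (EuclideanSpace ℝ d))),
      |FunctionSpaces.Torus.stLift θ q| ≤ M := by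
    filter_upwards [hq.ae h3] with q hq'
    simpa [FunctionSpaces.Torus.stLift, uncurry] using hq'
  have hprod : (volume.restrict (Ioo 0 T ×ˢ (univ : Set (EuclideanSpace ℝ d)))) = μT.prod volume := by
    rw [hμT, Measure.volume_eq_prod, ← Measure.prod_restrict, Measure.restrict_univ]
  unfold IsBoundedOnSlab
  rw [hprod] at hm ⊢
  exact memLp_top_of_bound hm M (h4.mono fun q hq' => by rw [Real.norm_eq_abs]; exact hq')

/-- **`L^∞` on the slab ⇒ iterated a.e. bound.** [folklore] -/
private theorem ae_ae_abs_le_of_isBoundedOnSlab {T : ℝ} {θ : ℝ → UnitAddTorus d → ℝ} (h : IsBoundedOnSlab T θ) :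
    ∃ M : ℝ, ∀ᵐ t ∂(volume.restrict (Ioo 0 T)), ∀ᵐ x ∂(volume : Measure (UnitAddTorus d)), |θ t x| ≤ M := by
  set μT : Measure ℝ := (volume : Measure ℝ).restrict (Ioo 0 T) with hμT
  set μ' : Measure (ℝ × EuclideanSpace ℝ d) := volume.restrict (Ioo 0 T ×ˢ univ) with hμ'
  set M : ℝ := (eLpNorm (FunctionSpaces.Torus.stLift θ) ∞ μ').toReal with hM
  have hfin : eLpNorm (FunctionSpaces.Torus.stLift θ) ∞ μ' ≠ ⊤ := h.eLpNorm_ne_top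
  have hae' : ∀ᵐ p ∂μ', |FunctionSpaces.Torus.stLift θ p| ≤ M := by
    filter_upwards [ae_le_eLpNormEssSup (f := FunctionSpaces.Torus.stLift θ) (μ := μ')] with p hp
    rw [← eLpNorm_exponent_top] at hp
    rw [← Real.norm_eq_abs, ← ENNReal.ofReal_le_iff_le_toReal hfin, ofReal_norm]
    exact hp
  refine ⟨M, ?_⟩
  have hprod : μ' = μT.prod volume := by
    rw [hμ', hμT, Measure.volume_eq_prod, ← Measure.prod_restrict, Measure.restrict_univ]
  rw [hprod] at hae'
  have hq := MeasureTheory.QuasiMeasurePreserving.prodMap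
    (Measure.QuasiMeasurePreserving.id μT) (FunctionSpaces.Torus.quasiMeasurePreserving_repr (d := d))
  have h2 : ∀ᵐ q ∂(μT.prod (volume : Measure (UnitAddTorus d))), |θ q.1 q.2| ≤ M := by
    filter_upwards [hq.ae hae'] with q hq'
    simpa [FunctionSpaces.Torus.stLift] using hq'
  exact Measure.ae_ae_of_ae_prod h2

/-- **The two renormalisation notions of the tree coincide.** The barrier's
`HasRenormalisationProperty T u` (bounded = iterated a.e. bound) and the statement file's
`Torus.HasRenormalizationPropertyOn T u` (bounded = `L^∞` of the space–time lift on the slab) are the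
same property of `u` on the half-open window `[0,T)`. [cite: BagnaraEtAl2026, Def. 2.1 p. 5] -/
theorem hasRenormalisationProperty_iff_hasRenormalizationPropertyOn {T : ℝ}
    {u : ℝ → UnitAddTorus d → EuclideanSpace ℝ d} :
    HasRenormalisationProperty T u ↔ HasRenormalizationPropertyOn T u := by
  constructor
  · intro h θin θ hθin hbd hsol β hβ
    exact h hθin (ae_ae_abs_le_of_isBoundedOnSlab hbd) hsol β hβ
  · intro h θ₀ θ hθ₀ hbd hsol β hβ
    obtain ⟨M, hM⟩ := hbd
    exact h hθ₀ (isBoundedOnSlab_of_ae_ae_abs_le hsol.aestronglyMeasurable hM) hsol β hβ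

/-! ## §2 The weak maximum principle of the class, `κ > 0`, bounded drift -/

/-- **Weak maximum principle** for `Torus.IsWeakScalarTransportOn` at `κ > 0` along a bounded drift:
if `|θ₀| ≤ H` a.e. then EVERY weak solution satisfies `|θ(t,x)| ≤ H` for a.e. `t ∈ (0,T)`, a.e. `x`.
Proof: a bounded weak solution with this bound exists [cite: MescoliniPitchoSorella2025, Thm. 2.4]
(`exists_isWeakScalarTransportOn_of_abs_le`), and weak solutions along bounded drifts are unique at
`κ > 0` [cite: BonicattoCiampaCrippa2023, Cor. 3.5] (`IsWeakScalarTransportOn.ae_eq_of_memLp_top`). -/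
theorem _root_.Literature.Analysis.FluidPDE.Torus.IsWeakScalarTransportOn.ae_ae_abs_le_of_memLp_top
    {T κ : ℝ} (hκ : 0 < κ)
    {u : ℝ → UnitAddTorus d → EuclideanSpace ℝ d} {θ₀ : UnitAddTorus d → ℝ} {θ : ℝ → UnitAddTorus d → ℝ}
    (h : IsWeakScalarTransportOn T κ u θ₀ θ)
    (hu : MemLp (FunctionSpaces.Torus.stLift u) ∞ (volume.restrict (Ioo 0 T ×ˢ univ)))
    (hθ₀m : AEStronglyMeasurable θ₀ volume) {H : ℝ}
    (hθ₀b : ∀ᵐ x ∂(volume : Measure (UnitAddTorus d)), |θ₀ x| ≤ H) :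
    ∀ᵐ t ∂(volume.restrict (Ioo 0 T)), ∀ᵐ x ∂(volume : Measure (UnitAddTorus d)), |θ t x| ≤ H := by
  classical
  rcases le_or_gt T 0 with hT | hT
  · have : (volume : Measure ℝ).restrict (Ioo 0 T) = 0 := by
      rw [Ioo_eq_empty_of_le hT, Measure.restrict_empty]
    rw [this, MeasureTheory.ae_zero]; exact Filter.eventually_bot
  obtain ⟨Θ, hΘ, -, hΘb, -⟩ := exists_isWeakScalarTransportOn_of_abs_le hκ hT hθ₀m hθ₀b
    h.aestronglyMeasurable_velocity (lintegral_lintegral_sq_lt_top_of_memLp_top_stLift hu) h.ae_isWeaklyDivFree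
  filter_upwards [IsWeakScalarTransportOn.ae_eq_of_memLp_top hκ h hΘ hu, hΘb] with t ht htb
  filter_upwards [ht, htb] with x hx hxb
  rw [hx]; exact hxb

/-! ## §3 BBDM Thm. 3.1 (3.1) on the full window, renormalisation beyond the window -/

/-- **Bagnara–Boutros–De Lellis–Mayboroda 2026, Thm. 3.1, conclusion (3.1) ON THE FULL WINDOW `(0,T)`.**
Let `0 < T < T'`, `u ∈ L^∞((0,T') × T^d)` weakly divergence free at a.e. time with the renormalisation
property on `[0,T')`, and `θ₀ ∈ L^∞`.  Then for every sequence `κₙ > 0`, `κₙ → 0`, and EVERY family of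
weak solutions `θₙ` of `∂ₜθ + u·∇θ = κₙΔθ`, `θ(0) = θ₀` on `[0,T)`: `κₙ ∫₀ᵀ ‖∇θₙ‖² → 0`.  The printed
hypothesis (Def. 2.1: renormalisation for weak solutions on `T^d × [0,∞)`) is global in time; over the
tree's half-open class the endpoint `T` is reached by asking renormalisation on some longer horizon.
[cite: BagnaraEtAl2026, Thm. 3.1 (3.1) p. 11, proof pp. 11–12] -/
theorem BagnaraBoutrosDeLellisMayboroda2026_thm31_fullWindow {T T' : ℝ} (hT : 0 < T) (hTT' : T < T')
    {u : ℝ → UnitAddTorus d → EuclideanSpace ℝ d}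
    (hu : MemLp (FunctionSpaces.Torus.stLift u) ∞ (volume.restrict (Ioo 0 T' ×ˢ univ)))
    (hdiv : ∀ᵐ t ∂(volume.restrict (Ioo 0 T')), FunctionSpaces.Torus.IsWeaklyDivFree (u t))
    (hren : HasRenormalisationProperty T' u)
    {θ₀ : UnitAddTorus d → ℝ} (hθ₀ : MemLp θ₀ ∞ volume)
    {κ : ℕ → ℝ} (hκ : ∀ n, 0 < κ n) (hκ0 : Tendsto κ atTop (𝓝 0))
    {θ : ℕ → ℝ → UnitAddTorus d → ℝ} (hsol : ∀ n, IsWeakScalarTransportOn T (κ n) u θ₀ (θ n)) :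
    Tendsto (fun n => eScalarDissipation (κ n) (θ n) 0 T) atTop (𝓝 0) := by
  classical
  have hT' : 0 < T' := hT.trans hTT'
  -- the datum is a.e. bounded by `H = ‖θ₀‖_∞`
  set H : ℝ := (eLpNorm θ₀ ∞ volume).toReal with hH
  have hθ₀b : ∀ᵐ x ∂(volume : Measure (UnitAddTorus d)), |θ₀ x| ≤ H := ae_abs_le_toReal_eLpNorm_of_memLp_top hθ₀
  -- bounded weak solutions on the longer horizon `[0,T')`
  have hum : AEStronglyMeasurable (FunctionSpaces.Torus.stLift u) (volume.restrict (Ioo 0 T' ×ˢ univ)) := hu.1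
  have hu2 := lintegral_lintegral_sq_lt_top_of_memLp_top_stLift hu
  have hex : ∀ n, ∃ Θ : ℝ → UnitAddTorus d → ℝ, IsWeakScalarTransportOn T' (κ n) u θ₀ Θ ∧
      ∀ᵐ t ∂(volume.restrict (Ioo 0 T')), ∀ᵐ x ∂(volume : Measure (UnitAddTorus d)), |Θ t x| ≤ H := by
    intro n
    obtain ⟨Θ, hΘ, -, hΘb, -⟩ := exists_isWeakScalarTransportOn_of_abs_le (hκ n) hT' hθ₀.1 hθ₀b hum hu2 hdiv
    exact ⟨Θ, hΘ, hΘb⟩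
  choose Θ hΘsol hΘb using hex
  -- the barrier theorem on the horizon `T'`, at `t₁ = T < T'`
  have hlim : Tendsto (fun n => eScalarDissipation (κ n) (Θ n) 0 T) atTop (𝓝 0) :=
    BagnaraBoutrosDeLellisMayboroda2026_thm31 hu hren hθ₀ hκ hκ0 hΘsol hΘb hTT'
  -- transfer to the given family by uniqueness on `[0,T)`
  have huT : MemLp (FunctionSpaces.Torus.stLift u) ∞ (volume.restrict (Ioo 0 T ×ˢ univ)) :=
    hu.mono_measure (Measure.restrict_mono (prod_mono (Ioo_subset_Ioo_right hTT'.le) subset_rfl) le_rfl)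
  have heq : ∀ n, eScalarDissipation (κ n) (θ n) 0 T = eScalarDissipation (κ n) (Θ n) 0 T := fun n =>
    eScalarDissipation_congr_ae
      (IsWeakScalarTransportOn.ae_eq_of_memLp_top (hκ n) (hsol n) ((hΘsol n).of_le hTT'.le) huT)
  simp_rw [heq]
  exact hlim

/-- **Filter form** of `BagnaraBoutrosDeLellisMayboroda2026_thm31_fullWindow` for a family indexed by the
diffusivity `ε > 0`: `ε ∫₀ᵀ ‖∇θ_ε‖² → 0` as `ε → 0⁺`. [cite: BagnaraEtAl2026, Thm. 3.1 (3.1) p. 11] -/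
theorem BagnaraBoutrosDeLellisMayboroda2026_thm31_fullWindow_nhdsWithin {T T' : ℝ} (hT : 0 < T) (hTT' : T < T')
    {u : ℝ → UnitAddTorus d → EuclideanSpace ℝ d}
    (hu : MemLp (FunctionSpaces.Torus.stLift u) ∞ (volume.restrict (Ioo 0 T' ×ˢ univ)))
    (hdiv : ∀ᵐ t ∂(volume.restrict (Ioo 0 T')), FunctionSpaces.Torus.IsWeaklyDivFree (u t))
    (hren : HasRenormalisationProperty T' u)
    {θ₀ : UnitAddTorus d → ℝ} (hθ₀ : MemLp θ₀ ∞ volume)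
    {θ : ℝ → ℝ → UnitAddTorus d → ℝ} (hsol : ∀ ε, 0 < ε → IsWeakScalarTransportOn T ε u θ₀ (θ ε)) :
    Tendsto (fun ε => eScalarDissipation ε (θ ε) 0 T) (𝓝[>] (0 : ℝ)) (𝓝 0) := by
  rw [tendsto_iff_seq_tendsto]
  intro x hx
  rw [tendsto_nhdsWithin_iff] at hx
  obtain ⟨hx0, hxpos⟩ := hx
  -- a positive modification of the sequence (agrees with `x` eventually)
  set κ : ℕ → ℝ := fun n => if 0 < x n then x n else 1 with hκdef
  have hκpos : ∀ n, 0 < κ n := fun n => by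
    simp only [hκdef]; split_ifs with h
    · exact h
    · exact one_pos
  have hκeq : ∀ᶠ n in atTop, κ n = x n := hxpos.mono fun n hn => by
    simp only [hκdef, mem_Ioi.1 hn, if_true]
  have hκ0 : Tendsto κ atTop (𝓝 0) := hx0.congr' (hκeq.mono fun n hn => hn.symm)
  have h := BagnaraBoutrosDeLellisMayboroda2026_thm31_fullWindow hT hTT' hu hdiv hren hθ₀ hκpos hκ0
    (θ := fun n => θ (κ n)) (fun n => hsol (κ n) (hκpos n))
  refine h.congr' (hκeq.mono fun n hn => ?_)
  simp only [Function.comp_apply, hn]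

/-! ## §4 The statement file's vocabulary: Def. 1.1 and Theorem 1.2 -/

/-- **No dissipation anomaly on `[0,T]` (BBDM Def. 1.1) along a bounded divergence-free drift with the
renormalisation property on a longer horizon `T' > T`** — the corrected form of the tree's reading of
Thm. 3.1 ⇒ ¬ Def. 1.1 (the false fact `BagnaraEtAl2026_thm31` asked only for the horizon `T`).
[cite: BagnaraEtAl2026, Thm. 3.1 p. 11 with Def. 1.1 p. 2] -/
theorem not_allowsDissipationAnomalyOn_of_hasRenormalizationPropertyOn_beyond {T T' : ℝ} (hT : 0 < T)
    (hTT' : T < T') {v : ℝ → UnitAddTorus d → EuclideanSpace ℝ d} (hv : IsBoundedOnSlab T' v)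
    (hdiv : ∀ᵐ t ∂(volume.restrict (Ioo 0 T')), FunctionSpaces.Torus.IsWeaklyDivFree (v t))
    (hren : HasRenormalizationPropertyOn T' v) :
    ¬ AllowsDissipationAnomalyOn T v := by
  refine not_allowsDissipationAnomalyOn_of_tendsto fun θin hθin θ hfam => ?_
  exact BagnaraBoutrosDeLellisMayboroda2026_thm31_fullWindow_nhdsWithin hT hTT' hv hdiv
    (hasRenormalisationProperty_iff_hasRenormalizationPropertyOn.2 hren) hθin (fun ε hε => (hfam ε hε).2)

/-- **Bagnara–Boutros–De Lellis–Mayboroda 2026, Theorem 1.2 (as typed: renormalisation on every horizon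
and no dissipation anomaly, almost surely) FROM §2.2 ALONE** — replaces the reduction
`BagnaraEtAl2026_thm12_of` through the false fact `BagnaraEtAl2026_thm31`: the source's Fubini step
(`∫ L²({v = 0}) dP(v) = ∫_{T²} P({v(x) = 0}) dx = 0`, §2.2 p. 5) gives `L²({v = 0}) = 0` a.s.;
`BagnaraEtAl2026_thm12_core` gives the renormalisation property of the autonomous field on EVERY
horizon, in particular on `T + 1 > T`, and §3 kills the anomaly on `[0,T]`.
[cite: BagnaraEtAl2026, Thm. 1.2 pp. 2–3, §2.2 p. 5, Thm. 3.1 p. 11] -/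
theorem BagnaraEtAl2026_thm12_of_core (hcore : BagnaraEtAl2026_thm12_core) : BagnaraEtAl2026_thm12 := by
  intro _ _ P _ hdiv hzero
  -- the zero set `S = {(v, x) : v x = 0}` is closed in `C(T², ℝ²) × T²`
  set S : Set (C(UnitAddTorus (Fin 2), EuclideanSpace ℝ (Fin 2)) × UnitAddTorus (Fin 2)) := {p | p.1 p.2 = 0}
    with hS_def
  have hS : IsClosed S := isClosed_eq (continuous_eval) continuous_const
  have hSm : MeasurableSet S := hS.measurableSet
  -- Tonelli: `(P ⊗ vol) S = ∫ P {v | v x = 0} dx = 0`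
  have hprod : (P.prod (volume : Measure (UnitAddTorus (Fin 2)))) S = 0 := by
    rw [Measure.prod_apply_symm hSm]
    have : (fun x : UnitAddTorus (Fin 2) =>
        P ((fun v : C(UnitAddTorus (Fin 2), EuclideanSpace ℝ (Fin 2)) => (v, x)) ⁻¹' S)) =ᵐ[volume] 0 := by
      filter_upwards [hzero] with x hx
      simpa [hS_def] using hx
    rw [lintegral_congr_ae this]
    simp
  -- hence `vol {x | v x = 0} = 0` for `P`-a.e. `v`
  have hae : ∀ᵐ v ∂P, (volume : Measure (UnitAddTorus (Fin 2))) {x | v x = 0} = 0 := by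
    rw [Measure.prod_apply hSm] at hprod
    have hmeas : Measurable fun v : C(UnitAddTorus (Fin 2), EuclideanSpace ℝ (Fin 2)) =>
        (volume : Measure (UnitAddTorus (Fin 2))) (Prod.mk v ⁻¹' S) :=
      measurable_measure_prodMk_left hSm
    have := (lintegral_eq_zero_iff hmeas).1 hprod
    filter_upwards [this] with v hv
    simpa [hS_def] using hv
  filter_upwards [hae, hdiv] with v hv hvdiv T hT
  have hrenT : HasRenormalizationPropertyOn T (fun _ x => v x) := hcore (fun x => v x) v.continuous hvdiv hv T hT
  have hrenT1 : HasRenormalizationPropertyOn (T + 1) (fun _ x => v x) :=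
    hcore (fun x => v x) v.continuous hvdiv hv (T + 1) (by linarith)
  -- the autonomous continuous field is bounded on every slab (maximum of `‖v‖` on the compact torus)
  have hbd : ∀ T₁ : ℝ, IsBoundedOnSlab T₁ (fun (_ : ℝ) (x : UnitAddTorus (Fin 2)) => v x) := by
    intro T₁
    have hcont : Continuous (FunctionSpaces.Torus.stLift (fun (_ : ℝ) (x : UnitAddTorus (Fin 2)) => v x)) := by
      have : FunctionSpaces.Torus.stLift (fun (_ : ℝ) (x : UnitAddTorus (Fin 2)) => v x) =
          fun p : ℝ × EuclideanSpace ℝ (Fin 2) => v (FunctionSpaces.Torus.proj p.2) := by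
        funext p; rfl
      rw [this]
      exact v.continuous.comp (FunctionSpaces.Torus.continuous_proj.comp continuous_snd)
    obtain ⟨C, hC⟩ := (isCompact_univ.image v.continuous).isBounded.exists_norm_le
    refine memLp_top_of_bound hcont.aestronglyMeasurable C (Eventually.of_forall fun p => ?_)
    exact hC _ ⟨FunctionSpaces.Torus.proj p.2, mem_univ _, rfl⟩
  exact ⟨hrenT, not_allowsDissipationAnomalyOn_of_hasRenormalizationPropertyOn_beyond hT (by linarith)
    (hbd (T + 1)) (Eventually.of_forall fun _ => hvdiv) hrenT1⟩

end Literature.Barriers.AnomalousDissipation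

end
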